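import Summits.HodgeConjecture.CorCM.MultiFieldWeilSimpleThreefoldCurves
import HarnessLib

/-!
# MULTI-FIELD WEIL ENGINE — A SIMPLE CM THREEFOLD WITH ANY FINITE FAMILY OF CM ELLIPTIC CURVES WHATSOEVER: the Hodge conjecture for every
# `T^c × ∏_a E_a^{n_a}`, given ONLY Markman's fourfold theorem

Cell `pub-hodgecm2` (COR-CM), seat b30 gen 33 (2026-08-24); count-neutral own lane MULTI-FIELD WEIL ENGINE (stem `MultiFieldWeil*`), sequel of
`CorCM/MultiFieldWeilSimpleThreefoldCurves.lean` (S8: the curves PAIRWISE NON-ISOGENOUS).  Theorems only; no definition, no named fact, no `sorry`.  HONEST FRAMING: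
conditional on the displayed Markman fourfold binder only; `HC_CM` is NOT proved and not asserted.

THE STATEMENT (**`hodgeConjectureFor_prod_simpleThreefold_anyCurves_of_markman`**).  `T ⊨ (K; Φ)` a SIMPLE abelian threefold with CM by a sextic CM field;
`E_a ⊨ (k_a; Ψ_a)` (`a ∈ I`, finite) ANY CM elliptic curves — isogenous or not, NOTHING assumed.  Then the Hodge conjecture holds for EVERY product of copies of `T`
and the `E_a` (`⨁_j (π j).elim T E`, `π : Fin N → Option I`), GIVEN ONLY `Markman2025_weilClasses_algebraic_abelianFourfold`.  PROOF.  Choose one curve in each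
isogeny class (the least index for an auxiliary linear order); the product is isogenous, slot by slot, to the same product with every curve replaced by the
representative of its class (`IsIsogenous.biproduct`), the representatives are pairwise non-isogenous, S8 applies to them, and the Hodge conjecture descends
along the isogeny (`Domination`).

[cite: MoonenZarhin1999LowDim, Thm. (0.1), (0.2), §3 (3.1), Cor. (3.9), §5 (5.2)] [cite: Markman2025SurveySecant, Thm. 1.2] [cite: MumfordAV1970, §19 Thm. 1 and p. 169]

## References
* [MoonenZarhin1999LowDim] B. Moonen, Yu. Zarhin, Math. Ann. 315 (1999) 711–733.  [Markman2025SurveySecant] E. Markman, arXiv:2509.23403, Thm. 1.2.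
  [MumfordAV1970] D. Mumford, *Abelian Varieties*, §19.
-/

noncomputable section

open CategoryTheory CategoryTheory.Limits NumberField IntermediateField

namespace Summit.HodgeConjecture.CorCM.MultiFieldWeil

open Literature.AlgebraicGeometry Literature.AlgebraicGeometry.Motives Literature.AlgebraicGeometry.HodgeTheory
open Literature.AlgebraicGeometry.ComplexMultiplication (IsCMTypeRealisation)
open Literature.AlgebraicTopology.SingularHomology
open Literature.NumberTheory.ComplexMultiplication

open scoped Classical

section AnyCurves

variable {I : Type} [Fintype I] {kq : I → Type} [∀ a, Field (kq a)] [∀ a, NumberField (kq a)] [∀ a, IsCMField (kq a)]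
  {E : I → AbelianVariety ℂ} {Ψ : ∀ a, CMType (kq a)} {ιE : ∀ a, 𝓞 (kq a) →+* End (E a)} {θE : ∀ a, kq a →+* Module.End ℂ (complexBetti (E a).X 1)}
  {K : Type} [Field K] [NumberField K] [IsCMField K] {T : AbelianVariety ℂ} {Φ : CMType K} {ιT : 𝓞 K →+* End T}
  {θT : K →+* Module.End ℂ (complexBetti T.X 1)}

/-- **A SIMPLE CM THREEFOLD WITH ANY FINITE FAMILY OF CM ELLIPTIC CURVES — given ONLY Markman's fourfold theorem.**  `T ⊨ (K; Φ)` a SIMPLE abelian threefold with CM by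
a sextic CM field; `E_a ⊨ (k_a; Ψ_a)` (`a ∈ I`, finite) CM elliptic curves — isogenous or not, nothing assumed on any field.  Then for every `π : Fin N → Option I` the
Hodge conjecture holds for `⨁_j (π j).elim T E` — every `T^c × ∏_a E_a^{n_a}` — GIVEN ONLY `Markman2025_weilClasses_algebraic_abelianFourfold` (one representative per
isogeny class, then `hodgeConjectureFor_prod_simpleThreefold_cmCurves_of_markman`, then the isogeny).  `HC_CM` is NOT asserted. [cite: MoonenZarhin1999LowDim, Thm. (0.2), Cor. (3.9)]
[cite: Markman2025SurveySecant, Thm. 1.2] [cite: MumfordAV1970, §19 Thm. 1 and p. 169] -/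
theorem hodgeConjectureFor_prod_simpleThreefold_anyCurves_of_markman (hW4 : Markman2025_weilClasses_algebraic_abelianFourfold) (h6 : Module.finrank ℚ K = 6)
    (hT : IsCMTypeRealisation Φ T ιT θT) (hS : T.IsSimple) (h2 : ∀ a, Module.finrank ℚ (kq a) = 2) (hE : ∀ a, IsCMTypeRealisation (Ψ a) (E a) (ιE a) (θE a))
    {N : ℕ} (π : Fin N → Option I) :
    HodgeConjectureFor (⨁ fun j => ((π j).elim T E : AbelianVariety ℂ)).dim (⨁ fun j => ((π j).elim T E : AbelianVariety ℂ)).X := by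
  -- an auxiliary linear order on `I`, and the least index of each isogeny class as its representative
  letI : LinearOrder I := LinearOrder.lift' (Fintype.equivFin I) (Fintype.equivFin I).injective
  let cl : I → Finset I := fun a => Finset.univ.filter fun b => AbelianVariety.IsIsogenous (E a) (E b)
  have hcl : ∀ a b, b ∈ cl a ↔ AbelianVariety.IsIsogenous (E a) (E b) := fun a b => by
    simp only [cl, Finset.mem_filter, Finset.mem_univ, true_and]
  have hne : ∀ a, (cl a).Nonempty := fun a => ⟨a, (hcl a a).2 (AbelianVariety.IsIsogenous.refl (E a))⟩
  let r : I → I := fun a => (cl a).min' (hne a)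
  have hr_iso : ∀ a, AbelianVariety.IsIsogenous (E a) (E (r a)) := fun a => (hcl a (r a)).1 (Finset.min'_mem _ (hne a))
  have hr_le : ∀ a b, AbelianVariety.IsIsogenous (E a) (E b) → r a ≤ r b := fun a b h =>
    Finset.min'_le (cl a) (r b) ((hcl a (r b)).2 (h.trans (hr_iso b)))
  have hr_eq : ∀ a b, AbelianVariety.IsIsogenous (E a) (E b) → r a = r b := fun a b h => le_antisymm (hr_le a b h) (hr_le b a h.symm')
  have hr_idem : ∀ a, r (r a) = r a := fun a => (hr_eq a (r a) (hr_iso a)).symm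
  -- the representatives, pairwise non-isogenous
  let J : Type := {b : I // r b = b}
  have hniJ : ∀ j j' : J, j ≠ j' → ¬ AbelianVariety.IsIsogenous (E j.1) (E j'.1) := fun j j' hne' h =>
    hne' (Subtype.ext (by rw [← j.2, ← j'.2]; exact hr_eq _ _ h))
  -- the product is isogenous, slot by slot, to the product over the representatives
  let ρ : I → J := fun a => ⟨r a, hr_idem a⟩
  have hiso : AbelianVariety.IsIsogenous (⨁ fun l => ((π l).elim T E : AbelianVariety ℂ))
      (⨁ fun l => (((π l).map ρ).elim T (fun j : J => E j.1) : AbelianVariety ℂ)) := by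
    refine AbelianVariety.IsIsogenous.biproduct fun l => ?_
    show AbelianVariety.IsIsogenous ((π l).elim T E) (((π l).map ρ).elim T fun j : J => E j.1)
    cases π l with
    | none => exact AbelianVariety.IsIsogenous.refl T
    | some a => exact hr_iso a
  exact Domination.hodgeConjectureFor_of_avDominatedBy
    (hodgeConjectureFor_prod_simpleThreefold_cmCurves_of_markman (kq := fun j : J => kq j.1) (E := fun j : J => E j.1) (Ψ := fun j : J => Ψ j.1)
      (ιE := fun j : J => ιE j.1) (θE := fun j : J => θE j.1) hW4 h6 hT hS (fun j => h2 j.1) (fun j => hE j.1) hniJ fun l => (π l).map ρ)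
    (Domination.AVDominatedBy.of_isIsogenous hiso (Domination.AVDominatedBy.refl _))

/-- **Dominated form**: everything dominated by a product of copies of a simple CM threefold and any CM elliptic curves (everything isogenous to such a product,
every abelian subvariety or quotient of one), given only Markman's fourfold theorem. [cite: MoonenZarhin1999LowDim, Thm. (0.2)] [cite: Markman2025SurveySecant, Thm. 1.2]
[cite: MumfordAV1970, §19 Thm. 1 and p. 169] -/
theorem hodgeConjectureFor_of_avDominatedBy_prod_simpleThreefold_anyCurves_of_markman (hW4 : Markman2025_weilClasses_algebraic_abelianFourfold)
    (h6 : Module.finrank ℚ K = 6) (hT : IsCMTypeRealisation Φ T ιT θT) (hS : T.IsSimple) (h2 : ∀ a, Module.finrank ℚ (kq a) = 2)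
    (hE : ∀ a, IsCMTypeRealisation (Ψ a) (E a) (ιE a) (θE a)) {N : ℕ} (π : Fin N → Option I) {X : AbelianVariety ℂ}
    (hX : Domination.AVDominatedBy X (⨁ fun j => ((π j).elim T E : AbelianVariety ℂ))) : HodgeConjectureFor X.dim X.X :=
  Domination.hodgeConjectureFor_of_avDominatedBy (hodgeConjectureFor_prod_simpleThreefold_anyCurves_of_markman hW4 h6 hT hS h2 hE π) hX

end AnyCurves

end Summit.HodgeConjecture.CorCM.MultiFieldWeil

end
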